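import Summits.QuantumAdvantage.QuantumAdvantage.Theorems.CubicForrelationNearExactIsExactTwelveWeight768Periods
import Summits.QuantumAdvantage.QuantumAdvantage.Theorems.CubicForrelationNearExactIsExactWalshTower
import Summits.QuantumAdvantage.QuantumAdvantage.Theorems.CubicForrelationNearExactIsExactAxParity
import Summits.QuantumAdvantage.QuantumAdvantage.Theorems.CubicForrelationNearExactIsExactTenBalancedA

/-!
# Crux `CubicForrelation.NearExactIsExact` (stmt-QuantumAdvantage-14043) — n = 12, configuration (β): the even set `Z` (768 points) is the
  disjoint union of SIX cosets `mᵢ ⊕ P` of its period group `P` (`#P = 128`)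

Certificate seat `b2b-cforr-cert` (gen 25).  HONEST FRAMING: a finite-slice structure lemma (standard axioms) about cubic Boolean functions on
12 bits — bookkeeping for the (β) × (β) kill at `Φ = 29/32` (plan HOME/b2b-cforr-cert-g25/PLAN-N12-928-BETA.md, "BREAKTHROUGH"); it claims NO
value of `θ₁₂`.  NOT summit progress.

`tbc_fibres`: for cubic `g` with `W_g = 64u''` and `#{u'' even} = 768`, with `P = {a : [u''(· ⊕ a) odd] = [u'' odd]}` (the period group of
`Z = {u'' even}`, `#P = 128` by `tw26_weight768_periods`): there are `m₁, …, m₆ ∈ Z`, pairwise in different `P`-cosets, such that every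
`x ∈ Z` lies in some `mᵢ ⊕ P`.  Also recorded: `P` is xor-closed with `0` (`tbc_P_zero`, `tbc_P_add`) and `Z` is `P`-stable (`tbc_Z_stable`).

References: T. Kasami, N. Tokura (1970); MacWilliams–Sloane (1977) Ch. 15.  Axioms: the standard three.
-/

set_option linter.dupNamespace false -- D-0017: single-problem summit ⇒ `QuantumAdvantage.QuantumAdvantage` by design

noncomputable section

namespace Summit.QuantumAdvantage.QuantumAdvantage.Theorems.CubicForrelation.NearExactIsExact

open Finset
open Literature.Computability.QuantumComplexity
open Literature.Computability.QuantumComplexity.BuzetChailloux (bxor zeroVec bxor_bxor_cancel_left bxor_zeroVec zeroVec_bxor bxor_comm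
  bxor_self)
open Literature.Computability.QuantumComplexity.DerivativeWalsh (W)

/-- `0` is a period. [folklore] -/
theorem tbc_P_zero (u'' : (Fin (6 + 6) → Bool) → ℤ) :
    zeroVec ∈ (univ.filter fun a : Fin (6 + 6) → Bool => ∀ x, decide (Odd (u'' (bxor x a))) = decide (Odd (u'' x))) :=
  mem_filter.2 ⟨mem_univ _, fun x => by rw [bxor_zeroVec]⟩

/-- Periods form an xor-closed set. [folklore] -/
theorem tbc_P_add (u'' : (Fin (6 + 6) → Bool) → ℤ) :
    ∀ a ∈ (univ.filter fun a : Fin (6 + 6) → Bool => ∀ x, decide (Odd (u'' (bxor x a))) = decide (Odd (u'' x))),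
    ∀ b ∈ (univ.filter fun a : Fin (6 + 6) → Bool => ∀ x, decide (Odd (u'' (bxor x a))) = decide (Odd (u'' x))),
      bxor a b ∈ (univ.filter fun a : Fin (6 + 6) → Bool => ∀ x, decide (Odd (u'' (bxor x a))) = decide (Odd (u'' x))) := by
  intro a ha b hb
  refine mem_filter.2 ⟨mem_univ _, fun x => ?_⟩
  rw [← iw_bxor_assoc, (mem_filter.1 hb).2, (mem_filter.1 ha).2]

/-- `Z = {u'' even}` is stable under its periods. [folklore] -/
theorem tbc_Z_stable (u'' : (Fin (6 + 6) → Bool) → ℤ) {x a : Fin (6 + 6) → Bool}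
    (hx : x ∈ (univ.filter fun x : Fin (6 + 6) → Bool => ¬ Odd (u'' x)))
    (ha : a ∈ (univ.filter fun a : Fin (6 + 6) → Bool => ∀ x, decide (Odd (u'' (bxor x a))) = decide (Odd (u'' x)))) :
    bxor x a ∈ (univ.filter fun x : Fin (6 + 6) → Bool => ¬ Odd (u'' x)) := by
  have h := (mem_filter.1 ha).2 x
  refine mem_filter.2 ⟨mem_univ _, fun hodd => (mem_filter.1 hx).2 ?_⟩
  have := decide_eq_true hodd
  rw [h] at this
  exact of_decide_eq_true this

/-- **`#P = 128` in the `u''`-vocabulary** (`tw26_weight768_periods` for the cubic `[u'' odd] ⊕ 1`). [this work] -/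
theorem tbc_card_P (g : (Fin (6 + 6) → Bool) → Bool) (hg : IsDegLeFun 3 g)
    (u'' : (Fin (6 + 6) → Bool) → ℤ) (hu'' : ∀ x, W (fun y => signOf (g y)) x = (2 : ℝ) ^ 6 * (u'' x : ℝ))
    (h768 : #(univ.filter fun x : Fin (6 + 6) → Bool => ¬ Odd (u'' x)) = 768) :
    #(univ.filter fun a : Fin (6 + 6) → Bool => ∀ x, decide (Odd (u'' (bxor x a))) = decide (Odd (u'' x))) = 128 := by
  classical
  have hp : IsDegLeFun 3 (fun x => decide (Odd (u'' x))) :=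
    stub_walshTower stub_axParity (6 + 6) 6 3 g u'' hg hu'' (by intro k hk hkn; omega)
  have hp' : IsDegLeFun 3 (fun x => decide (Odd (u'' x)) ^^ true) := tb_isDegLeFun_xor_const hp true
  have hfilt : (univ.filter fun x : Fin (6 + 6) → Bool => (decide (Odd (u'' x)) ^^ true) = true) =
      univ.filter (fun x : Fin (6 + 6) → Bool => ¬ Odd (u'' x)) := filter_congr fun x _ => by simp
  have h := tw26_weight768_periods (fun x => decide (Odd (u'' x)) ^^ true) hp' (by rw [hfilt, h768])
  have e : (univ.filter fun a : Fin (6 + 6) → Bool => ∀ x, (decide (Odd (u'' (bxor x a))) ^^ true) = (decide (Odd (u'' x)) ^^ true)) =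
      univ.filter (fun a : Fin (6 + 6) → Bool => ∀ x, decide (Odd (u'' (bxor x a))) = decide (Odd (u'' x))) := by
    refine filter_congr fun a _ => ?_
    refine forall_congr' fun x => ?_
    cases decide (Odd (u'' (bxor x a))) <;> cases decide (Odd (u'' x)) <;> simp
  rw [e] at h
  exact h

/-- **Six fibre representatives.**  For cubic `g` with `W_g = 64u''` and `#{u'' even} = 768`: there are `m₁, …, m₆` in `Z = {u'' even}`,
pairwise in different cosets of the period group `P`, with `Z ⊆ ⋃ᵢ mᵢ ⊕ P`. [this work] -/
theorem tbc_fibres (g : (Fin (6 + 6) → Bool) → Bool) (hg : IsDegLeFun 3 g)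
    (u'' : (Fin (6 + 6) → Bool) → ℤ) (hu'' : ∀ x, W (fun y => signOf (g y)) x = (2 : ℝ) ^ 6 * (u'' x : ℝ))
    (h768 : #(univ.filter fun x : Fin (6 + 6) → Bool => ¬ Odd (u'' x)) = 768) :
    ∃ m₁ m₂ m₃ m₄ m₅ m₆ : Fin (6 + 6) → Bool,
      (m₁ ∈ (univ.filter fun x : Fin (6 + 6) → Bool => ¬ Odd (u'' x)) ∧ m₂ ∈ (univ.filter fun x : Fin (6 + 6) → Bool => ¬ Odd (u'' x)) ∧
       m₃ ∈ (univ.filter fun x : Fin (6 + 6) → Bool => ¬ Odd (u'' x)) ∧ m₄ ∈ (univ.filter fun x : Fin (6 + 6) → Bool => ¬ Odd (u'' x)) ∧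
       m₅ ∈ (univ.filter fun x : Fin (6 + 6) → Bool => ¬ Odd (u'' x)) ∧ m₆ ∈ (univ.filter fun x : Fin (6 + 6) → Bool => ¬ Odd (u'' x))) ∧
      (∀ a b : Fin (6 + 6) → Bool, (a, b) ∈ [(m₁, m₂), (m₁, m₃), (m₁, m₄), (m₁, m₅), (m₁, m₆), (m₂, m₃), (m₂, m₄), (m₂, m₅), (m₂, m₆),
          (m₃, m₄), (m₃, m₅), (m₃, m₆), (m₄, m₅), (m₄, m₆), (m₅, m₆)] →
        bxor a b ∉ (univ.filter fun a : Fin (6 + 6) → Bool => ∀ x, decide (Odd (u'' (bxor x a))) = decide (Odd (u'' x)))) ∧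
      (∀ x ∈ (univ.filter fun x : Fin (6 + 6) → Bool => ¬ Odd (u'' x)),
        bxor m₁ x ∈ (univ.filter fun a : Fin (6 + 6) → Bool => ∀ x, decide (Odd (u'' (bxor x a))) = decide (Odd (u'' x))) ∨
        bxor m₂ x ∈ (univ.filter fun a : Fin (6 + 6) → Bool => ∀ x, decide (Odd (u'' (bxor x a))) = decide (Odd (u'' x))) ∨
        bxor m₃ x ∈ (univ.filter fun a : Fin (6 + 6) → Bool => ∀ x, decide (Odd (u'' (bxor x a))) = decide (Odd (u'' x))) ∨
        bxor m₄ x ∈ (univ.filter fun a : Fin (6 + 6) → Bool => ∀ x, decide (Odd (u'' (bxor x a))) = decide (Odd (u'' x))) ∨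
        bxor m₅ x ∈ (univ.filter fun a : Fin (6 + 6) → Bool => ∀ x, decide (Odd (u'' (bxor x a))) = decide (Odd (u'' x))) ∨
        bxor m₆ x ∈ (univ.filter fun a : Fin (6 + 6) → Bool => ∀ x, decide (Odd (u'' (bxor x a))) = decide (Odd (u'' x)))) := by
  classical
  set Z := univ.filter (fun x : Fin (6 + 6) → Bool => ¬ Odd (u'' x)) with hZdef
  set P := (univ.filter fun a : Fin (6 + 6) → Bool => ∀ x, decide (Odd (u'' (bxor x a))) = decide (Odd (u'' x))) with hPdef
  have hP : #P = 128 := tbc_card_P g hg u'' hu'' h768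
  have hPadd := tbc_P_add u''
  -- cosets `C m = m ⊕ P`
  have hCsub : ∀ m ∈ Z, P.image (bxor m) ⊆ Z := fun m hm y hy => by
    obtain ⟨a, ha, rfl⟩ := mem_image.1 hy; exact tbc_Z_stable u'' hm ha
  have hCcard : ∀ m, #(P.image (bxor m)) = 128 := fun m => by
    rw [card_image_of_injective _ (fun a b hab => by simpa [bxor_bxor_cancel_left] using congrArg (bxor m) hab), hP]
  have hmemC : ∀ m x, x ∈ P.image (bxor m) ↔ bxor m x ∈ P := by
    intro m x
    constructor
    · intro h; obtain ⟨a, ha, rfl⟩ := mem_image.1 h; rwa [bxor_bxor_cancel_left]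
    · intro h; exact mem_image.2 ⟨bxor m x, h, bxor_bxor_cancel_left _ _⟩
  -- two cosets are disjoint unless the second representative lies in the first
  have hdisj : ∀ m m', m' ∉ P.image (bxor m) → Disjoint (P.image (bxor m)) (P.image (bxor m')) := by
    intro m m' hm'
    rw [disjoint_left]
    intro y hy hy'
    obtain ⟨a, ha, rfl⟩ := mem_image.1 hy
    obtain ⟨b, hb, hab⟩ := mem_image.1 hy'
    apply hm'
    refine mem_image.2 ⟨bxor a b, hPadd a ha b hb, ?_⟩
    have : m' = bxor (bxor m a) b := by
      have h' : bxor (bxor m' b) b = bxor (bxor m a) b := by rw [hab]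
      rw [iw_bxor_assoc, bxor_self, bxor_zeroVec] at h'
      exact h'
    rw [this, iw_bxor_assoc]
  -- greedy choice of six representatives
  obtain ⟨m₁, hm₁⟩ : Z.Nonempty := card_pos.1 (by rw [h768]; norm_num)
  set Z₁ := Z \ P.image (bxor m₁) with hZ₁
  have hZ₁card : #Z₁ = 640 := by rw [hZ₁, card_sdiff_of_subset (hCsub m₁ hm₁), h768, hCcard]
  obtain ⟨m₂, hm₂⟩ : Z₁.Nonempty := card_pos.1 (by rw [hZ₁card]; norm_num)
  have hm₂Z : m₂ ∈ Z := (mem_sdiff.1 hm₂).1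
  have hm₂1 : m₂ ∉ P.image (bxor m₁) := (mem_sdiff.1 hm₂).2
  set Z₂ := Z₁ \ P.image (bxor m₂) with hZ₂
  have hC2 : P.image (bxor m₂) ⊆ Z₁ := fun y hy => mem_sdiff.2 ⟨hCsub m₂ hm₂Z hy, disjoint_right.1 (hdisj m₁ m₂ hm₂1) hy⟩
  have hZ₂card : #Z₂ = 512 := by rw [hZ₂, card_sdiff_of_subset hC2, hZ₁card, hCcard]
  obtain ⟨m₃, hm₃⟩ : Z₂.Nonempty := card_pos.1 (by rw [hZ₂card]; norm_num)
  have hm₃Z₁ : m₃ ∈ Z₁ := (mem_sdiff.1 hm₃).1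
  have hm₃Z : m₃ ∈ Z := (mem_sdiff.1 hm₃Z₁).1
  have hm₃1 : m₃ ∉ P.image (bxor m₁) := (mem_sdiff.1 hm₃Z₁).2
  have hm₃2 : m₃ ∉ P.image (bxor m₂) := (mem_sdiff.1 hm₃).2
  set Z₃ := Z₂ \ P.image (bxor m₃) with hZ₃
  have hC3 : P.image (bxor m₃) ⊆ Z₂ := fun y hy =>
    mem_sdiff.2 ⟨mem_sdiff.2 ⟨hCsub m₃ hm₃Z hy, disjoint_right.1 (hdisj m₁ m₃ hm₃1) hy⟩, disjoint_right.1 (hdisj m₂ m₃ hm₃2) hy⟩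
  have hZ₃card : #Z₃ = 384 := by rw [hZ₃, card_sdiff_of_subset hC3, hZ₂card, hCcard]
  obtain ⟨m₄, hm₄⟩ : Z₃.Nonempty := card_pos.1 (by rw [hZ₃card]; norm_num)
  have hm₄Z₂ : m₄ ∈ Z₂ := (mem_sdiff.1 hm₄).1
  have hm₄Z₁ : m₄ ∈ Z₁ := (mem_sdiff.1 hm₄Z₂).1
  have hm₄Z : m₄ ∈ Z := (mem_sdiff.1 hm₄Z₁).1
  have hm₄1 : m₄ ∉ P.image (bxor m₁) := (mem_sdiff.1 hm₄Z₁).2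
  have hm₄2 : m₄ ∉ P.image (bxor m₂) := (mem_sdiff.1 hm₄Z₂).2
  have hm₄3 : m₄ ∉ P.image (bxor m₃) := (mem_sdiff.1 hm₄).2
  set Z₄ := Z₃ \ P.image (bxor m₄) with hZ₄
  have hC4 : P.image (bxor m₄) ⊆ Z₃ := fun y hy =>
    mem_sdiff.2 ⟨mem_sdiff.2 ⟨mem_sdiff.2 ⟨hCsub m₄ hm₄Z hy, disjoint_right.1 (hdisj m₁ m₄ hm₄1) hy⟩,
      disjoint_right.1 (hdisj m₂ m₄ hm₄2) hy⟩, disjoint_right.1 (hdisj m₃ m₄ hm₄3) hy⟩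
  have hZ₄card : #Z₄ = 256 := by rw [hZ₄, card_sdiff_of_subset hC4, hZ₃card, hCcard]
  obtain ⟨m₅, hm₅⟩ : Z₄.Nonempty := card_pos.1 (by rw [hZ₄card]; norm_num)
  have hm₅Z₃ : m₅ ∈ Z₃ := (mem_sdiff.1 hm₅).1
  have hm₅Z₂ : m₅ ∈ Z₂ := (mem_sdiff.1 hm₅Z₃).1
  have hm₅Z₁ : m₅ ∈ Z₁ := (mem_sdiff.1 hm₅Z₂).1
  have hm₅Z : m₅ ∈ Z := (mem_sdiff.1 hm₅Z₁).1
  have hm₅1 : m₅ ∉ P.image (bxor m₁) := (mem_sdiff.1 hm₅Z₁).2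
  have hm₅2 : m₅ ∉ P.image (bxor m₂) := (mem_sdiff.1 hm₅Z₂).2
  have hm₅3 : m₅ ∉ P.image (bxor m₃) := (mem_sdiff.1 hm₅Z₃).2
  have hm₅4 : m₅ ∉ P.image (bxor m₄) := (mem_sdiff.1 hm₅).2
  set Z₅ := Z₄ \ P.image (bxor m₅) with hZ₅
  have hC5 : P.image (bxor m₅) ⊆ Z₄ := fun y hy =>
    mem_sdiff.2 ⟨mem_sdiff.2 ⟨mem_sdiff.2 ⟨mem_sdiff.2 ⟨hCsub m₅ hm₅Z hy, disjoint_right.1 (hdisj m₁ m₅ hm₅1) hy⟩,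
      disjoint_right.1 (hdisj m₂ m₅ hm₅2) hy⟩, disjoint_right.1 (hdisj m₃ m₅ hm₅3) hy⟩, disjoint_right.1 (hdisj m₄ m₅ hm₅4) hy⟩
  have hZ₅card : #Z₅ = 128 := by rw [hZ₅, card_sdiff_of_subset hC5, hZ₄card, hCcard]
  obtain ⟨m₆, hm₆⟩ : Z₅.Nonempty := card_pos.1 (by rw [hZ₅card]; norm_num)
  have hm₆Z₄ : m₆ ∈ Z₄ := (mem_sdiff.1 hm₆).1
  have hm₆Z₃ : m₆ ∈ Z₃ := (mem_sdiff.1 hm₆Z₄).1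
  have hm₆Z₂ : m₆ ∈ Z₂ := (mem_sdiff.1 hm₆Z₃).1
  have hm₆Z₁ : m₆ ∈ Z₁ := (mem_sdiff.1 hm₆Z₂).1
  have hm₆Z : m₆ ∈ Z := (mem_sdiff.1 hm₆Z₁).1
  have hm₆1 : m₆ ∉ P.image (bxor m₁) := (mem_sdiff.1 hm₆Z₁).2
  have hm₆2 : m₆ ∉ P.image (bxor m₂) := (mem_sdiff.1 hm₆Z₂).2
  have hm₆3 : m₆ ∉ P.image (bxor m₃) := (mem_sdiff.1 hm₆Z₃).2
  have hm₆4 : m₆ ∉ P.image (bxor m₄) := (mem_sdiff.1 hm₆Z₄).2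
  have hm₆5 : m₆ ∉ P.image (bxor m₅) := (mem_sdiff.1 hm₆).2
  set Z₆ := Z₅ \ P.image (bxor m₆) with hZ₆
  have hC6 : P.image (bxor m₆) ⊆ Z₅ := fun y hy =>
    mem_sdiff.2 ⟨mem_sdiff.2 ⟨mem_sdiff.2 ⟨mem_sdiff.2 ⟨mem_sdiff.2 ⟨hCsub m₆ hm₆Z hy, disjoint_right.1 (hdisj m₁ m₆ hm₆1) hy⟩,
      disjoint_right.1 (hdisj m₂ m₆ hm₆2) hy⟩, disjoint_right.1 (hdisj m₃ m₆ hm₆3) hy⟩, disjoint_right.1 (hdisj m₄ m₆ hm₆4) hy⟩,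
      disjoint_right.1 (hdisj m₅ m₆ hm₆5) hy⟩
  have hZ₆card : #Z₆ = 0 := by rw [hZ₆, card_sdiff_of_subset hC6, hZ₅card, hCcard]
  have hZ₆e : Z₆ = ∅ := card_eq_zero.1 hZ₆card
  refine ⟨m₁, m₂, m₃, m₄, m₅, m₆, ⟨hm₁, hm₂Z, hm₃Z, hm₄Z, hm₅Z, hm₆Z⟩, ?_, ?_⟩
  · intro a b hab
    simp only [List.mem_cons, Prod.mk.injEq, List.mem_nil_iff, or_false] at hab
    have key : ∀ m m' : Fin (6 + 6) → Bool, m' ∉ P.image (bxor m) → bxor m m' ∉ P := fun m m' h hP => h ((hmemC m m').2 hP)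
    rcases hab with ⟨rfl, rfl⟩ | ⟨rfl, rfl⟩ | ⟨rfl, rfl⟩ | ⟨rfl, rfl⟩ | ⟨rfl, rfl⟩ | ⟨rfl, rfl⟩ | ⟨rfl, rfl⟩ | ⟨rfl, rfl⟩ |
        ⟨rfl, rfl⟩ | ⟨rfl, rfl⟩ | ⟨rfl, rfl⟩ | ⟨rfl, rfl⟩ | ⟨rfl, rfl⟩ | ⟨rfl, rfl⟩ | ⟨rfl, rfl⟩
    · exact key _ _ hm₂1
    · exact key _ _ hm₃1
    · exact key _ _ hm₄1
    · exact key _ _ hm₅1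
    · exact key _ _ hm₆1
    · exact key _ _ hm₃2
    · exact key _ _ hm₄2
    · exact key _ _ hm₅2
    · exact key _ _ hm₆2
    · exact key _ _ hm₄3
    · exact key _ _ hm₅3
    · exact key _ _ hm₆3
    · exact key _ _ hm₅4
    · exact key _ _ hm₆4
    · exact key _ _ hm₆5
  · intro x hx
    by_contra hno
    simp only [not_or] at hno
    obtain ⟨h1, h2, h3, h4, h5, h6⟩ := hno
    have : x ∈ Z₆ := by
      rw [hZ₆, mem_sdiff, hZ₅, mem_sdiff, hZ₄, mem_sdiff, hZ₃, mem_sdiff, hZ₂, mem_sdiff, hZ₁, mem_sdiff]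
      exact ⟨⟨⟨⟨⟨⟨hx, fun h => h1 ((hmemC _ _).1 h)⟩, fun h => h2 ((hmemC _ _).1 h)⟩, fun h => h3 ((hmemC _ _).1 h)⟩,
        fun h => h4 ((hmemC _ _).1 h)⟩, fun h => h5 ((hmemC _ _).1 h)⟩, fun h => h6 ((hmemC _ _).1 h)⟩
    rw [hZ₆e] at this
    exact notMem_empty _ this

end Summit.QuantumAdvantage.QuantumAdvantage.Theorems.CubicForrelation.NearExactIsExact

end
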